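import Mathlib.Analysis.Convex.Deriv
import Summits.HubbardSuperconductivity.HubbardSuperconductivity.Theorems.ThermalWedgeTwSeededEnsembleEquivalenceRDanskinEnvelope
import Summits.HubbardSuperconductivity.HubbardSuperconductivity.Theorems.ThermalWedgeTwSeededEnsembleEquivalenceRSourcedPressureBasics

/-!
# Crux `TwSeededEnsembleEquivalenceR` (stmt-HubbardSuperconductivity-15581), line `cold-floor-collapse`
# (slug `Sketch`) — the physics stub S4 from its parts: EDGE is free-gas arithmetic

Support file (`--supports stmt-HubbardSuperconductivity-15581`; sorry-free; no definition; route-file free).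
The registered physics stub `stub_sourcedColdRegularity` (S4) asks, at the cold slice `β = e^{a/U}`, for
(DIFF/UNIQ) a common `μ`-slope of the sourced limit pressure at all optimal sources and (EDGE) two interior
points whose slopes bracket `1 − δ`. Here S4 is DERIVED from
* S3 `stub_sourcedPressureLimit` (thermodynamic limit of the sourced pressure, used for the FREE gas),
* S4a `stub_sourcedColdDiffUniq` — DIFF/UNIQ alone, on every compact window of `(−4, 0)` (THE physics),
* S4b `stub_freeColdEdgeIncrements` — two increments of the FREE (`U = 0`) cold BdG limit pressure:
  over `[−3.9 − u, −3.86]` at most `(3/5)·(1/25)` and over `[−0.09, −0.05 − u]` at least `(9/10)·(1/25)`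
  (`β ≥ 20`, `0 ≤ u ≤ 1/2000`, `|h| ≤ 3`; free BdG densities `≈ 0.50` resp. `≈ 0.94` — numerics-grade),
through the free sandwich `p̃_L(β,0,μ−U/2,h) ≤ p̃_L(β,U,μ,h) ≤ p̃_L(β,0,μ,h)` (`stub_sourcedPressureSandwich`)
and convexity in `μ`: the slope `d` of `μ ↦ q μ h*` at `μm = −3.9` is at most the secant over
`[μm, μm + s]`, which the sandwich bounds by the free increment over `[μm − U/2, μm + s]`; symmetrically at
`μp = −0.05`. Window: `[−3.99, −0.01]` for every `δ ∈ [1/10, 2/5]`. [folklore composition]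
-/

set_option linter.dupNamespace false

namespace Summit.HubbardSuperconductivity.HubbardSuperconductivity.Theorems.TwSeededEnsembleEquivalenceR.ColdFloorLine

open Matrix Filter Topology Finset Literature.MathematicalPhysics.QuantumLattice
open scoped ComplexOrder Matrix.Norms.L2Operator

noncomputable section

/-! ### Two more inheritance lemmas -/

/-- A pointwise limit on a convex set `S` of functions convex on `S` is convex on `S`. [folklore] -/
theorem cfc_convexOn_of_limit {S : Set ℝ} (hS : Convex ℝ S) {f : ℕ → ℝ → ℝ} {F : ℝ → ℝ}
    (hf : ∀ n, ConvexOn ℝ S (f n))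
    (hlim : ∀ x ∈ S, ∀ κ : ℝ, 0 < κ → ∃ N : ℕ, ∀ n, N ≤ n → |f n x - F x| ≤ κ) :
    ConvexOn ℝ S F := by
  refine ⟨hS, fun x hx y hy a b ha hb hab => ?_⟩
  apply le_of_forall_pos_lt_add
  intro ε hε
  have hz : a • x + b • y ∈ S := hS hx hy ha hb hab
  obtain ⟨N₁, hN₁⟩ := hlim (a • x + b • y) hz (ε / 4) (by positivity)
  obtain ⟨N₂, hN₂⟩ := hlim x hx (ε / 4) (by positivity)
  obtain ⟨N₃, hN₃⟩ := hlim y hy (ε / 4) (by positivity)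
  set n := max N₁ (max N₂ N₃) with hn
  have h1 := hN₁ n (le_max_left _ _)
  have h2 := hN₂ n ((le_max_left _ _).trans (le_max_right _ _))
  have h3 := hN₃ n ((le_max_right _ _).trans (le_max_right _ _))
  have hc := (hf n).2 hx hy ha hb hab
  rw [abs_le] at h1 h2 h3
  simp only [smul_eq_mul] at hc h1 ⊢
  have ha' : a * f n x ≤ a * (F x + ε / 4) := mul_le_mul_of_nonneg_left (by linarith) ha
  have hb' : b * f n y ≤ b * (F y + ε / 4) := mul_le_mul_of_nonneg_left (by linarith) hb
  nlinarith [h1.1, h1.2, ha', hb', hc, hab]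

section Sourced

variable (L : ℕ) [NeZero L]

/-- **The sourced pressure is Lipschitz in the source** with the `L`-independent constant
`C_d = 2 · (2 Σ_e |ĝ_d(e)/√2|)` (`‖Δ_d + Δ_dᴴ‖ ≤ 2‖Δ_d‖`, tree bound `norm_pairField_le`; the sharp value
`8√2` is `abs_sourcedPressure_sub_le`). [folklore] -/
theorem cfc_abs_sourcedPressure_sub_h_le (U μ : ℝ) {β : ℝ} (hβ : 0 < β) (h h' : ℝ) :
    |Real.log (partitionFn β (dWaveSourceTorus L U μ h)).re / (β * (L : ℝ) ^ 2) -
        Real.log (partitionFn β (dWaveSourceTorus L U μ h')).re / (β * (L : ℝ) ^ 2)| ≤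
      (2 * (2 * ∑ e ∈ insert (0 : Literature.Probability.LatticeModels.Site 2)
        unitSteps, |dWaveFormFactor e / Real.sqrt 2|)) * |h - h'| := by
  have hL := cast_sq_pos_of_neZero L
  have hβL : 0 < β * (L : ℝ) ^ 2 := mul_pos hβ hL
  rw [← sub_div, abs_div, abs_of_pos hβL, div_le_iff₀ hβL]
  have key := abs_log_partitionFn_sub_log_partitionFn_le
    (dWaveSourceTorus_isHermitian L (isHermitian_hubbardTorusWith L 1 U μ) h)
    (dWaveSourceTorus_isHermitian L (isHermitian_hubbardTorusWith L 1 U μ) h') hβ.le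
  refine key.trans ?_
  have hsub : dWaveSourceTorus L U μ h - dWaveSourceTorus L U μ h' =
      ((h' - h : ℝ) : ℂ) • (pairField dWaveFormFactor L + (pairField dWaveFormFactor L)ᴴ) := by
    simp only [dWaveSourceTorus]
    push_cast
    rw [sub_smul]
    abel
  rw [hsub, norm_smul, Complex.norm_real, Real.norm_eq_abs, abs_sub_comm]
  have hn := norm_pairField_le dWaveFormFactor L
  have hn2 : ‖pairField dWaveFormFactor L + (pairField dWaveFormFactor L)ᴴ‖ ≤
      2 * ((2 * ∑ e ∈ insert (0 : Literature.Probability.LatticeModels.Site 2)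
        unitSteps, |dWaveFormFactor e / Real.sqrt 2|) * (L : ℝ) ^ 2) := by
    calc ‖pairField dWaveFormFactor L + (pairField dWaveFormFactor L)ᴴ‖
        ≤ ‖pairField dWaveFormFactor L‖ + ‖(pairField dWaveFormFactor L)ᴴ‖ := norm_add_le _ _
      _ = 2 * ‖pairField dWaveFormFactor L‖ := by rw [Matrix.l2_opNorm_conjTranspose]; ring
      _ ≤ _ := by gcongr
  calc β * (|h - h'| * ‖pairField dWaveFormFactor L + (pairField dWaveFormFactor L)ᴴ‖)
      ≤ β * (|h - h'| * (2 * ((2 * ∑ e ∈ insert (0 : Literature.Probability.LatticeModels.Site 2)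
        unitSteps, |dWaveFormFactor e / Real.sqrt 2|) * (L : ℝ) ^ 2))) := by
        gcongr
    _ = (2 * (2 * ∑ e ∈ insert (0 : Literature.Probability.LatticeModels.Site 2)
        unitSteps, |dWaveFormFactor e / Real.sqrt 2|)) * |h - h'| *
          (β * (L : ℝ) ^ 2) := by ring

/-- The free sandwich at the level of pressures (`β > 0`, `U ≥ 0`):
`p̃_L(β,0,μ−U/2,h) ≤ p̃_L(β,U,μ,h) ≤ p̃_L(β,0,μ,h)`. [folklore] -/
theorem cfc_sourcedPressure_sandwich {U β : ℝ} (hU : 0 ≤ U) (hβ : 0 < β) (μ h : ℝ) :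
    Real.log (partitionFn β (dWaveSourceTorus L 0 (μ - U / 2) h)).re / (β * (L : ℝ) ^ 2) ≤
        Real.log (partitionFn β (dWaveSourceTorus L U μ h)).re / (β * (L : ℝ) ^ 2) ∧
      Real.log (partitionFn β (dWaveSourceTorus L U μ h)).re / (β * (L : ℝ) ^ 2) ≤
        Real.log (partitionFn β (dWaveSourceTorus L 0 μ h)).re / (β * (L : ℝ) ^ 2) := by
  have hβL : 0 < β * (L : ℝ) ^ 2 := mul_pos hβ (cast_sq_pos_of_neZero L)
  obtain ⟨h1, h2⟩ := cfb_log_partitionFn_sandwich L hU hβ.le μ h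
  exact ⟨div_le_div_of_nonneg_right h1 hβL.le, div_le_div_of_nonneg_right h2 hβL.le⟩

end Sourced

/-! ### S4 from its parts -/

/-- **S4 (`stub_sourcedColdRegularity`) from S3 + S4a + S4b.** With the fixed geometry
`μ₁ = −3.99`, `μm = −3.9`, `s = 1/25`, `μp = −1/20`, `μ₂ = −1/100` (serving every `δ ∈ [1/10, 2/5]`):
the common slope at `μm` is `≤` the `μ`-secant of `q(·, h*)` over `[μm, μm + s]` (convexity), which the free
sandwich bounds by the FREE increment over `[μm − U/2, μm + s]`, `≤ (3/5)s ≤ (1 − δ)s` (S4b); symmetrically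
the slope at `μp` is `≥ (9/10) ≥ 1 − δ`. `U₀` is cut down to `min U₀ (min (1/1000) (a/log 20))` so that
`U/2 ≤ 1/2000` and `e^{a/U} ≥ 20`. [folklore composition] -/
theorem sourcedColdRegularity_of_parts :
    (∀ (β U μ h : ℝ), 0 < β → ∃ q : ℝ, ∀ κ : ℝ, 0 < κ → ∃ L₀ : ℕ, ∀ (L : ℕ) [NeZero L], L₀ ≤ L →
      |Real.log (Matrix.partitionFn β (dWaveSourceTorus L U μ h)).re / (β * (L : ℝ) ^ 2) - q| ≤ κ) →
    (∀ (μ₁ μ₂ : ℝ), -4 < μ₁ → μ₁ < μ₂ → μ₂ < 0 → ∃ a K' U₀ : ℝ, 0 < a ∧ 0 < K' ∧ 0 < U₀ ∧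
      ∀ U ∈ Set.Ioc (0 : ℝ) U₀, ∀ g ∈ Set.Icc (K' * U) (1 / 10), ∀ q : ℝ → ℝ → ℝ,
        (∀ μ ∈ Set.Icc μ₁ μ₂, ∀ h ∈ Set.Icc (-(13 * g + 1)) (13 * g + 1), ∀ κ : ℝ, 0 < κ →
          ∃ L₀ : ℕ, ∀ (L : ℕ) [NeZero L], L₀ ≤ L →
            |Real.log (Matrix.partitionFn (Real.exp (a / U)) (dWaveSourceTorus L U μ h)).re /
                (Real.exp (a / U) * (L : ℝ) ^ 2) - q μ h| ≤ κ) →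
        ∀ μ ∈ Set.Ioo μ₁ μ₂, ∃ d : ℝ, ∀ h ∈ Set.Icc (-(13 * g + 1)) (13 * g + 1),
          q μ h - h ^ 2 / g =
              sSup ((fun h' : ℝ => q μ h' - h' ^ 2 / g) '' Set.Icc (-(13 * g + 1)) (13 * g + 1)) →
            HasDerivAt (fun μ' => q μ' h) d μ) →
    (∀ (β u h : ℝ), 20 ≤ β → 0 ≤ u → u ≤ 1 / 2000 → |h| ≤ 3 → ∀ q₀ : ℝ → ℝ,
      (∀ μ ∈ Set.Icc (-4 : ℝ) 0, ∀ κ : ℝ, 0 < κ → ∃ L₀ : ℕ, ∀ (L : ℕ) [NeZero L], L₀ ≤ L →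
        |Real.log (Matrix.partitionFn β (dWaveSourceTorus L 0 μ h)).re / (β * (L : ℝ) ^ 2) - q₀ μ| ≤ κ) →
      q₀ (-(39 / 10) + 1 / 25) - q₀ (-(39 / 10) - u) ≤ 3 / 5 * (1 / 25) ∧
        9 / 10 * (1 / 25) ≤ q₀ (-(1 / 20) - u) - q₀ (-(1 / 20) - 1 / 25)) →
    ∀ δ ∈ Set.Icc (1/10 : ℝ) (2/5 : ℝ), ∃ μ₁ μ₂ : ℝ, -4 < μ₁ ∧ μ₁ < μ₂ ∧ μ₂ < 0 ∧
      ∃ a K' U₀ : ℝ, 0 < a ∧ 0 < K' ∧ 0 < U₀ ∧ ∀ U ∈ Set.Ioc (0 : ℝ) U₀,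
        ∀ g ∈ Set.Icc (K' * U) (1 / 10), ∀ q : ℝ → ℝ → ℝ,
          (∀ μ ∈ Set.Icc μ₁ μ₂, ∀ h ∈ Set.Icc (-(13 * g + 1)) (13 * g + 1), ∀ κ : ℝ, 0 < κ →
            ∃ L₀ : ℕ, ∀ (L : ℕ) [NeZero L], L₀ ≤ L →
              |Real.log (Matrix.partitionFn (Real.exp (a / U)) (dWaveSourceTorus L U μ h)).re /
                  (Real.exp (a / U) * (L : ℝ) ^ 2) - q μ h| ≤ κ) →
          (∀ μ ∈ Set.Ioo μ₁ μ₂, ∃ d : ℝ, ∀ h ∈ Set.Icc (-(13 * g + 1)) (13 * g + 1),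
            q μ h - h ^ 2 / g =
                sSup ((fun h' : ℝ => q μ h' - h' ^ 2 / g) '' Set.Icc (-(13 * g + 1)) (13 * g + 1)) →
              HasDerivAt (fun μ' => q μ' h) d μ) ∧
          (∃ μm ∈ Set.Ioo μ₁ μ₂, ∃ μp ∈ Set.Ioo μ₁ μ₂, ∃ dm dp : ℝ, dm ≤ 1 - δ ∧ 1 - δ ≤ dp ∧
            (∀ h ∈ Set.Icc (-(13 * g + 1)) (13 * g + 1),
              q μm h - h ^ 2 / g =
                  sSup ((fun h' : ℝ => q μm h' - h' ^ 2 / g) '' Set.Icc (-(13 * g + 1)) (13 * g + 1)) →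
                HasDerivAt (fun μ' => q μ' h) dm μm) ∧
            (∀ h ∈ Set.Icc (-(13 * g + 1)) (13 * g + 1),
              q μp h - h ^ 2 / g =
                  sSup ((fun h' : ℝ => q μp h' - h' ^ 2 / g) '' Set.Icc (-(13 * g + 1)) (13 * g + 1)) →
                HasDerivAt (fun μ' => q μ' h) dp μp)) := by
  intro hS3 hA hB δ hδ
  -- fixed geometry
  obtain ⟨a, K', U₀, ha, hK', hU₀, hreg⟩ := hA (-(399 / 100)) (-(1 / 100)) (by norm_num) (by norm_num)
    (by norm_num)
  have hlog20 : 0 < Real.log 20 := Real.log_pos (by norm_num)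
  set U₁ : ℝ := min U₀ (min (1 / 1000) (a / Real.log 20)) with hU₁def
  have hU₁pos : 0 < U₁ := lt_min hU₀ (lt_min (by norm_num) (div_pos ha hlog20))
  refine ⟨-(399 / 100), -(1 / 100), by norm_num, by norm_num, by norm_num, a, K', U₁, ha, hK', hU₁pos,
    fun U hU g hg q hq => ?_⟩
  have hUU₀ : U ∈ Set.Ioc (0 : ℝ) U₀ := ⟨hU.1, hU.2.trans (min_le_left _ _)⟩
  have hU1000 : U ≤ 1 / 1000 := hU.2.trans ((min_le_right _ _).trans (min_le_left _ _))
  have hUa : U ≤ a / Real.log 20 := hU.2.trans ((min_le_right _ _).trans (min_le_right _ _))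
  have hUpos : 0 < U := hU.1
  set β : ℝ := Real.exp (a / U) with hβdef
  have hβ : 0 < β := Real.exp_pos _
  have hβ20 : 20 ≤ β := by
    have h1 : Real.log 20 ≤ a / U := by
      rw [le_div_iff₀ hUpos]
      calc Real.log 20 * U ≤ Real.log 20 * (a / Real.log 20) :=
            mul_le_mul_of_nonneg_left hUa hlog20.le
        _ = a := by field_simp
    calc (20 : ℝ) = Real.exp (Real.log 20) := (Real.exp_log (by norm_num)).symm
      _ ≤ Real.exp (a / U) := Real.exp_le_exp.2 h1
  have hg0 : 0 < g := lt_of_lt_of_le (mul_pos hK' hUpos) hg.1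
  set H : ℝ := 13 * g + 1 with hHdef
  have hH : 0 ≤ H := by positivity
  have hH3 : H ≤ 3 := by rw [hHdef]; linarith [hg.2]
  -- (DIFF/UNIQ) from S4a
  have hDU := hreg U hUU₀ g hg q hq
  -- tools: sequences `n ↦ p̃_{n+1}`, the free limits (S3), `h`-Lipschitz and `μ`-convexity of `q` on the
  -- box, and the sandwich in the limit
  have hseq : ∀ μ ∈ Set.Icc (-(399 / 100) : ℝ) (-(1 / 100)), ∀ h ∈ Set.Icc (-H) H, ∀ κ : ℝ, 0 < κ →
      ∃ N : ℕ, ∀ n, N ≤ n →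
        |Real.log (partitionFn β (dWaveSourceTorus (n + 1) U μ h)).re / (β * (((n + 1 : ℕ) : ℝ)) ^ 2) -
          q μ h| ≤ κ := by
    intro μ hμ h hh κ hκ
    obtain ⟨L₀, hL₀⟩ := hq μ hμ h hh κ hκ
    exact ⟨L₀, fun n hn => hL₀ (n + 1) (by omega)⟩
  choose q₀f hq₀f using fun μ h => hS3 β 0 μ h hβ
  have hseq0 : ∀ μ h : ℝ, ∀ κ : ℝ, 0 < κ → ∃ N : ℕ, ∀ n, N ≤ n →
      |Real.log (partitionFn β (dWaveSourceTorus (n + 1) 0 μ h)).re / (β * (((n + 1 : ℕ) : ℝ)) ^ 2) -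
        q₀f μ h| ≤ κ := by
    intro μ h κ hκ
    obtain ⟨L₀, hL₀⟩ := hq₀f μ h κ hκ
    exact ⟨L₀, fun n hn => hL₀ (n + 1) (by omega)⟩
  set Cd : ℝ := 2 * (2 * ∑ e ∈ insert (0 : Literature.Probability.LatticeModels.Site 2)
    unitSteps, |dWaveFormFactor e / Real.sqrt 2|) with hCd
  have hLh : ∀ μ ∈ Set.Icc (-(399 / 100) : ℝ) (-(1 / 100)), ∀ h ∈ Set.Icc (-H) H, ∀ h' ∈ Set.Icc (-H) H,
      |q μ h - q μ h'| ≤ Cd * |h - h'| := by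
    intro μ hμ h hh h' hh'
    refine cfb_abs_sub_le_of_limits (hseq μ hμ h hh) (hseq μ hμ h' hh') fun n => ?_
    have := cfc_abs_sourcedPressure_sub_h_le (n + 1) U μ hβ h h'
    exact_mod_cast this
  have hconvW : ∀ h ∈ Set.Icc (-H) H,
      ConvexOn ℝ (Set.Icc (-(399 / 100) : ℝ) (-(1 / 100))) (fun μ => q μ h) := by
    intro h hh
    refine cfc_convexOn_of_limit (convex_Icc _ _) (f := fun n μ =>
      Real.log (partitionFn β (dWaveSourceTorus (n + 1) U μ h)).re / (β * (((n + 1 : ℕ) : ℝ)) ^ 2))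
      (fun n => ?_) (fun μ hμ κ hκ => hseq μ hμ h hh κ hκ)
    have := (cfb_convexOn_sourcedPressure (n + 1) U h hβ).subset
      (Set.subset_univ (Set.Icc (-(399 / 100) : ℝ) (-(1 / 100)))) (convex_Icc (-(399 / 100) : ℝ) (-(1 / 100)))
    simpa using this
  have hupper : ∀ μ ∈ Set.Icc (-(399 / 100) : ℝ) (-(1 / 100)), ∀ h ∈ Set.Icc (-H) H, q μ h ≤ q₀f μ h := by
    intro μ hμ h hh
    refine cfb_le_of_limits (hseq μ hμ h hh) (hseq0 μ h) fun n => ?_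
    have := (cfc_sourcedPressure_sandwich (n + 1) hUpos.le hβ μ h).2
    simpa using this
  have hlower : ∀ μ ∈ Set.Icc (-(399 / 100) : ℝ) (-(1 / 100)), ∀ h ∈ Set.Icc (-H) H,
      q₀f (μ - U / 2) h ≤ q μ h := by
    intro μ hμ h hh
    refine cfb_le_of_limits (hseq0 (μ - U / 2) h) (hseq μ hμ h hh) fun n => ?_
    have := (cfc_sourcedPressure_sandwich (n + 1) hUpos.le hβ μ h).1
    simpa using this
  have habs3 : ∀ h ∈ Set.Icc (-H) H, |h| ≤ 3 := fun h hh =>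
    abs_le.2 ⟨by linarith [hh.1], by linarith [hh.2]⟩
  have hu0 : 0 ≤ U / 2 := by linarith
  have hu1 : U / 2 ≤ 1 / 2000 := by linarith
  refine ⟨hDU, -(39 / 10), ⟨by norm_num, by norm_num⟩, -(1 / 20), ⟨by norm_num, by norm_num⟩, ?_⟩
  obtain ⟨dm, hdm⟩ := hDU (-(39 / 10)) ⟨by norm_num, by norm_num⟩
  obtain ⟨dp, hdp⟩ := hDU (-(1 / 20)) ⟨by norm_num, by norm_num⟩
  refine ⟨dm, dp, ?_, ?_, hdm, hdp⟩
  · -- EDGE at `μm = −3.9`: slope ≤ right secant ≤ free increment / s ≤ 3/5 ≤ 1 − δ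
    have hμmW : (-(39 / 10) : ℝ) ∈ Set.Icc (-(399 / 100) : ℝ) (-(1 / 100)) := ⟨by norm_num, by norm_num⟩
    have hμsW : (-(39 / 10) + 1 / 25 : ℝ) ∈ Set.Icc (-(399 / 100) : ℝ) (-(1 / 100)) :=
      ⟨by norm_num, by norm_num⟩
    obtain ⟨hs, hsS, -, hsup⟩ :=
      danskin_exists_max (fun _ h => q (-(39 / 10)) h) g hH (fun _ => hLh (-(39 / 10)) hμmW) (-(39 / 10))
    have hsup' : q (-(39 / 10)) hs - hs ^ 2 / g =
        sSup ((fun h' : ℝ => q (-(39 / 10)) h' - h' ^ 2 / g) '' Set.Icc (-H) H) := hsup.symm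
    have hD : HasDerivAt (fun μ' => q μ' hs) dm (-(39 / 10)) := hdm hs hsS hsup'
    have hsl := (hconvW hs hsS).le_slope_of_hasDerivAt hμmW hμsW (by norm_num) hD
    rw [slope_def_field] at hsl
    have hden : (-(39 / 10) + 1 / 25 - -(39 / 10) : ℝ) = 1 / 25 := by norm_num
    rw [hden, le_div_iff₀ (by norm_num : (0 : ℝ) < 1 / 25)] at hsl
    have h1 := hupper (-(39 / 10) + 1 / 25) hμsW hs hsS
    have h2 := hlower (-(39 / 10)) hμmW hs hsS
    have hBm := (hB β (U / 2) hs hβ20 hu0 hu1 (habs3 hs hsS) (fun μ => q₀f μ hs)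
      (fun μ _ κ hκ => hq₀f μ hs κ hκ)).1
    linarith [hδ.2]
  · -- EDGE at `μp = −1/20`: slope ≥ left secant ≥ free increment / s ≥ 9/10 ≥ 1 − δ
    have hμpW : (-(1 / 20) : ℝ) ∈ Set.Icc (-(399 / 100) : ℝ) (-(1 / 100)) := ⟨by norm_num, by norm_num⟩
    have hμsW : (-(1 / 20) - 1 / 25 : ℝ) ∈ Set.Icc (-(399 / 100) : ℝ) (-(1 / 100)) :=
      ⟨by norm_num, by norm_num⟩
    obtain ⟨hs, hsS, -, hsup⟩ :=
      danskin_exists_max (fun _ h => q (-(1 / 20)) h) g hH (fun _ => hLh (-(1 / 20)) hμpW) (-(1 / 20))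
    have hsup' : q (-(1 / 20)) hs - hs ^ 2 / g =
        sSup ((fun h' : ℝ => q (-(1 / 20)) h' - h' ^ 2 / g) '' Set.Icc (-H) H) := hsup.symm
    have hD : HasDerivAt (fun μ' => q μ' hs) dp (-(1 / 20)) := hdp hs hsS hsup'
    have hsl := (hconvW hs hsS).slope_le_of_hasDerivAt hμsW hμpW (by norm_num) hD
    rw [slope_def_field] at hsl
    have hden : (-(1 / 20) - (-(1 / 20) - 1 / 25) : ℝ) = 1 / 25 := by norm_num
    rw [hden, div_le_iff₀ (by norm_num : (0 : ℝ) < 1 / 25)] at hsl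
    have h1 := hlower (-(1 / 20)) hμpW hs hsS
    have h2 := hupper (-(1 / 20) - 1 / 25) hμsW hs hsS
    have hBp := (hB β (U / 2) hs hβ20 hu0 hu1 (habs3 hs hsS) (fun μ => q₀f μ hs)
      (fun μ _ κ hκ => hq₀f μ hs κ hκ)).2
    linarith [hδ.1]

end

end Summit.HubbardSuperconductivity.HubbardSuperconductivity.Theorems.TwSeededEnsembleEquivalenceR.ColdFloorLine
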